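import Mathlib
import Summits.CriticalPhenomena.PercolationContinuityZ3.Theorems.PercNearOneGluingNoHeavyLowerTailOrderedDifferencesIndependent

/-!
# The Marica–Schönheim pencil over an ARBITRARY field: reduction to 2-chain periodicity, and the down-closed case

Helper file for crux `stmt-CriticalPhenomena-4575` (`NoHeavyLowerTail`, route `PercNearOneGluingNoHeavy`),
new-inequality factory seat `prim-ineq-gen-3` (gen 21).  Everything here is PROVED; no definitions.

Notation (memo `run/shared/lean/prim/prim-ineq-gen-3/CONJECTURE-P2.md`): for a finite family `𝒜` with difference family
`D = 𝒜 \\ 𝒜`, `Z A E = [E ⊆ A]` and `Y A E = [E ∩ A = ∅]` (`A ∈ 𝒜`, `E ∈ D`); the PENCIL rows are `Z A + t • Y A`.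
Gen 20 proved that the pencil rows are independent over `ℚ` for every rational `t ≠ ±1`
(`OrderedDifferences.linearIndependent_pencil_diffs`, integrality of eigenvalues).  CONJECTURE MS-PENCIL/𝔽 asks for the same over
EVERY field (every `t` with `t² ≠ 1`).  Gen 21 isolates the parameter-free core:

**2-chain periodicity (P2).**  If `λ Z = μ Y` and `μ Z = ν Y` (as functions on `D`) then `λ = ν`.

* `linearIndependent_incidence_of_rank_field`, `linearIndependent_incidence_diffs_field` — the (ordered) Marica–Schönheim rank
  theorem over an arbitrary field (gen 18 proved it over `ℚ`; the integer Möbius weights of gen 20 make the same proof work over any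
  field).
* `linearIndependent_pencil_of_twoChain` — over any field `K`: P2 for `𝒜` ⟹ the pencil rows over `𝒜 \\ 𝒜` are independent for
  every `t` with `t * t ≠ 1`.  [A dependency `c (Z + tY) = 0` is the 2-chain `c → -t c → t² c`, so `c = t² c`.]
* `twoChain_of_diffs_downClosed` — P2 holds whenever `𝒜 \\ 𝒜` is closed under taking subsets (e.g. `𝒜` a down-set), over any
  field: then `Y = Z Ψ` for the signed containment matrix `Ψ F E = (-1)^{#F} [F ⊆ E]` of `D`, an involution.
* `linearIndependent_pencil_of_diffs_downClosed` — hence MS-PENCIL/𝔽 for all families with subset-closed difference family.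
* `twoChain_of_complClosed`, `linearIndependent_pencil_of_complClosed` — the same for families closed under complement
  in a fixed ground set `S` (there `Y A = Z (S \\ A)` on `𝒜 \\ 𝒜`, and complementation is an involution of `𝒜`).

P2 itself (all families) is OPEN: verified for all 65 535 families on 4 points over GF(3), GF(5), GF(7), GF(13), for random and
generic-position families on up to 10 points over `ℚ`, and (pair form) over GF(2); the natural strengthening "relations of 2-chains
extend to the down-closure of `D`" is FALSE (three sets in general position).  (prim-ineq-gen-3 gen 21, 2026-08-23.)
-/

namespace Summit.CriticalPhenomena.PercolationContinuityZ3.Theorems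

namespace OrderedDifferences

open Finset Matrix
open scoped FinsetFamily

variable {α : Type*} [DecidableEq α] {K : Type*} [Field K]

/-- Integer Möbius weights (local copy of `exists_moebius_weights_int`): `∑_{E ∈ T, E ⊆ Z} μ E = [Z = ∅]` for `Z ∈ T`. -/
private theorem moebius_weights_int_aux (T : Finset (Finset α)) :
    ∃ μ : Finset α → ℤ, ∀ Z ∈ T, ∑ E ∈ T.filter (· ⊆ Z), μ E = if Z = ∅ then 1 else 0 := by
  let H : (s : Finset α) → ((t : Finset α) → t ⊂ s → ℤ) → ℤ := fun s ih =>
    (if s = ∅ then (1 : ℤ) else 0) - ∑ t ∈ (T.filter (· ⊂ s)).attach, ih t.1 (mem_filter.mp t.2).2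
  let μ : Finset α → ℤ := Finset.strongInduction H
  have hμ : ∀ s, μ s = (if s = ∅ then (1 : ℤ) else 0) - ∑ t ∈ T.filter (· ⊂ s), μ t := by
    intro s
    have e : μ s = H s (fun t _ => μ t) := Finset.strongInduction_eq H s
    rw [e]
    show (if s = ∅ then (1 : ℤ) else 0) - ∑ t ∈ (T.filter (· ⊂ s)).attach, μ t.1 = _
    rw [sum_attach (T.filter (· ⊂ s)) (fun t => μ t)]
  refine ⟨μ, fun Z hZ => ?_⟩
  have hsplit : T.filter (· ⊆ Z) = insert Z (T.filter (· ⊂ Z)) := by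
    ext E
    simp only [mem_filter, mem_insert]
    refine ⟨fun ⟨hE, hEZ⟩ => (lt_or_eq_of_le hEZ).elim (fun h => Or.inr ⟨hE, h⟩) Or.inl, ?_⟩
    rintro (rfl | ⟨hE, hEZ⟩)
    · exact ⟨hZ, subset_rfl⟩
    · exact ⟨hE, hEZ.le⟩
  have hnot : Z ∉ T.filter (· ⊂ Z) := fun h => lt_irrefl Z (mem_filter.mp h).2
  rw [hsplit, sum_insert hnot, hμ]
  abel

/-- **Ordered Marica–Schönheim over an arbitrary field.**  Under the hypotheses of `card_le_card_of_rank` (a rank function `r`,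
`A i ⊄ A j` for `i ≠ j` with `r i ≤ r j`, and `A i \ A j ∈ T` whenever `r i ≤ r j`) the plain incidence rows `i ↦ (E ↦ [E ⊆ A i])`
over `T` are linearly independent over ANY field `K` (same Möbius-weighted unitriangular pairing as over `ℚ`, with integer weights). -/
theorem linearIndependent_incidence_of_rank_field {ι β : Type*} [Fintype ι] [DecidableEq ι] [LinearOrder β]
    (A : ι → Finset α) (r : ι → β) (hA : ∀ ⦃i j : ι⦄, i ≠ j → r i ≤ r j → ¬ A i ⊆ A j)
    (T : Finset (Finset α)) (hT : ∀ ⦃i j : ι⦄, r i ≤ r j → A i \ A j ∈ T) :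
    LinearIndependent K (fun i : ι => fun E : T => if (E : Finset α) ⊆ A i then (1 : K) else 0) := by
  classical
  obtain ⟨μ, hμ⟩ := moebius_weights_int_aux T
  have key : ∀ i j : ι, r i ≤ r j →
      ∑ E ∈ T.filter (· ⊆ A i \ A j), (μ E : K) = if i = j then 1 else 0 := by
    intro i j hij
    have h := hμ _ (hT hij)
    have h' : (∑ E ∈ T.filter (· ⊆ A i \ A j), (μ E : K)) = ((if A i \ A j = ∅ then (1 : ℤ) else 0 : ℤ) : K) := by
      rw [← h]; push_cast; rfl
    rw [h']
    by_cases h0 : i = j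
    · subst h0
      simp
    · have hne : A i \ A j ≠ ∅ := fun he => hA h0 hij (sdiff_eq_empty_iff_subset.mp he)
      simp [h0, hne]
  -- the three matrices: plain incidence `U`, Möbius-weighted `P = U * diagonal μ`, tests `Q`
  let U : Matrix ι T K := fun i E => if (E : Finset α) ⊆ A i then 1 else 0
  let P : Matrix ι T K := fun i E => if (E : Finset α) ⊆ A i then (μ E : K) else 0
  let Q : Matrix T ι K := fun E j => if Disjoint (E : Finset α) (A j) then 1 else 0
  have hPU : P = U * Matrix.diagonal (fun E : T => (μ E : K)) := by
    ext i E
    rw [Matrix.mul_diagonal]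
    by_cases h : (E : Finset α) ⊆ A i <;> simp [U, P, h]
  have hPQ : ∀ i j, (P * Q) i j = ∑ E ∈ T.filter (· ⊆ A i \ A j), (μ E : K) := by
    intro i j
    rw [Matrix.mul_apply]
    have h1 : ∑ E : T, P i E * Q E j =
        ∑ E ∈ T, (if E ⊆ A i then (μ E : K) else 0) * (if Disjoint E (A j) then 1 else 0) :=
      Finset.sum_coe_sort T (fun E => (if E ⊆ A i then (μ E : K) else 0) *
        (if Disjoint E (A j) then 1 else 0))
    rw [h1, sum_filter]
    refine sum_congr rfl fun E _ => ?_
    by_cases ha : E ⊆ A i <;> by_cases hb : Disjoint E (A j) <;> simp [ha, hb, subset_sdiff]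
  have hzero : ∀ i j : ι, i ≠ j → r i ≤ r j → (P * Q) i j = 0 := by
    intro i j hij hr
    rw [hPQ, key i j hr, if_neg hij]
  have hone : ∀ i : ι, (P * Q) i i = 1 := by
    intro i
    rw [hPQ, key i i le_rfl, if_pos rfl]
  have hBT : (P * Q).BlockTriangular (OrderDual.toDual ∘ r) := by
    intro i j hij
    have hij' : r i < r j := hij
    exact hzero i j (fun h => by subst h; exact lt_irrefl _ hij') hij'.le
  have hdet : (P * Q).det = 1 := by
    rw [hBT.det]
    refine prod_eq_one fun a _ => ?_
    have hblock : (P * Q).toSquareBlock (OrderDual.toDual ∘ r) a = 1 := by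
      ext ⟨i, hi⟩ ⟨j, hj⟩
      rw [toSquareBlock_def, of_apply]
      by_cases h : i = j
      · subst h
        rw [hone, one_apply_eq]
      · have hr : r i = r j := by
          have h1 : OrderDual.toDual (r i) = a := hi
          have h2 : OrderDual.toDual (r j) = a := hj
          exact OrderDual.toDual.injective (h1.trans h2.symm)
        rw [hzero i j h hr.le, one_apply_ne (fun h' => h (Subtype.ext_iff.mp h'))]
    rw [hblock, det_one]
  have hunit : IsUnit (P * Q) := by
    rw [Matrix.isUnit_iff_isUnit_det, hdet]
    exact isUnit_one
  have hrankU : U.rank = Fintype.card ι := by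
    apply le_antisymm (rank_le_card_height U)
    calc Fintype.card ι = (P * Q).rank := (rank_of_isUnit _ hunit).symm
      _ ≤ P.rank := rank_mul_le_left P Q
      _ = (U * Matrix.diagonal (fun E : T => (μ E : K))).rank := by rw [hPU]
      _ ≤ U.rank := rank_mul_le_left _ _
  have hli : LinearIndependent K U.row := by
    rw [linearIndependent_iff_card_eq_finrank_span, Set.finrank, ← Matrix.rank_eq_finrank_span_row, hrankU]
  exact hli

/-- **Marica–Schönheim as a rank certificate over an arbitrary field.**  For every finite family `𝒜` of finite sets the incidence rows
`A ↦ (E ↦ [E ⊆ A])` over `𝒜 \\ 𝒜` are linearly independent over any field `K`. -/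
theorem linearIndependent_incidence_diffs_field (𝒜 : Finset (Finset α)) :
    LinearIndependent K (fun A : 𝒜 => fun E : (𝒜 \\ 𝒜 : Finset (Finset α)) =>
      if (E : Finset α) ⊆ (A : Finset α) then (1 : K) else 0) := by
  classical
  refine linearIndependent_incidence_of_rank_field (ι := ↥𝒜) (fun A => (A : Finset α))
    (fun A => -(#(A : Finset α) : ℤ)) ?_ (𝒜 \\ 𝒜) ?_
  · rintro ⟨X, hX⟩ ⟨Y, hY⟩ hne hr hXY
    simp only at hr hXY
    have hle : #Y ≤ #X := by omega
    exact hne (Subtype.ext (eq_of_subset_of_card_le hXY hle))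
  · rintro ⟨X, hX⟩ ⟨Y, hY⟩ -
    exact mem_diffs.mpr ⟨X, hX, Y, hY, rfl⟩

/-- Pointwise consequence of `linearIndependent_incidence_diffs_field`: if `∑_A c_A [E ⊆ A] = 0` for every `E ∈ 𝒜 \\ 𝒜` then `c = 0`. -/
theorem eq_zero_of_sum_incidence_diffs_eq_zero (𝒜 : Finset (Finset α)) (c : ↥𝒜 → K)
    (hc : ∀ E ∈ 𝒜 \\ 𝒜, ∑ A : 𝒜, c A * (if E ⊆ (A : Finset α) then (1 : K) else 0) = 0) : c = 0 := by
  classical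
  have hli := linearIndependent_incidence_diffs_field (K := K) 𝒜
  rw [Fintype.linearIndependent_iff] at hli
  funext A
  refine hli c ?_ A
  funext E
  simp only [Finset.sum_apply, Pi.smul_apply, smul_eq_mul, Pi.zero_apply]
  exact hc E E.2

/-- **2-chain periodicity ⟹ the pencil theorem, over any field.**  Suppose the family `𝒜` has the 2-CHAIN PERIODICITY property:
whenever `∑_A λ_A [E ⊆ A] = ∑_A μ_A [E ∩ A = ∅]` and `∑_A μ_A [E ⊆ A] = ∑_A ν_A [E ∩ A = ∅]` for all `E ∈ 𝒜 \\ 𝒜`, then `λ = ν`.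
Then for every `t ∈ K` with `t * t ≠ 1` the pencil rows `A ↦ (E ↦ [E ⊆ A] + t [E ∩ A = ∅])` over `𝒜 \\ 𝒜` are linearly independent
over `K`.  (A dependency `c` is the 2-chain `c → -t c → t² c`.) -/
theorem linearIndependent_pencil_of_twoChain (𝒜 : Finset (Finset α))
    (hP2 : ∀ l m n : ↥𝒜 → K,
      (∀ E ∈ 𝒜 \\ 𝒜, ∑ A : 𝒜, l A * (if E ⊆ (A : Finset α) then (1 : K) else 0) =
        ∑ A : 𝒜, m A * (if Disjoint E (A : Finset α) then (1 : K) else 0)) →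
      (∀ E ∈ 𝒜 \\ 𝒜, ∑ A : 𝒜, m A * (if E ⊆ (A : Finset α) then (1 : K) else 0) =
        ∑ A : 𝒜, n A * (if Disjoint E (A : Finset α) then (1 : K) else 0)) → l = n)
    {t : K} (ht : t * t ≠ 1) :
    LinearIndependent K (fun A : 𝒜 => fun E : (𝒜 \\ 𝒜 : Finset (Finset α)) =>
      (if (E : Finset α) ⊆ (A : Finset α) then (1 : K) else 0) +
        t * (if Disjoint (E : Finset α) (A : Finset α) then (1 : K) else 0)) := by
  classical
  rw [Fintype.linearIndependent_iff]
  intro c hc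
  -- pointwise form of the dependency
  have hdep : ∀ E ∈ 𝒜 \\ 𝒜, ∑ A : 𝒜, c A * (if E ⊆ (A : Finset α) then (1 : K) else 0) +
      t * ∑ A : 𝒜, c A * (if Disjoint E (A : Finset α) then (1 : K) else 0) = 0 := by
    intro E hE
    have h := congr_fun hc ⟨E, hE⟩
    simp only [Finset.sum_apply, Pi.smul_apply, smul_eq_mul, Pi.zero_apply] at h
    have e : ∑ A : 𝒜, c A * (if E ⊆ (A : Finset α) then (1 : K) else 0) +
        t * ∑ A : 𝒜, c A * (if Disjoint E (A : Finset α) then (1 : K) else 0) =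
        ∑ A : 𝒜, c A * ((if E ⊆ (A : Finset α) then (1 : K) else 0) +
          t * (if Disjoint E (A : Finset α) then (1 : K) else 0)) := by
      rw [mul_sum, ← sum_add_distrib]
      refine sum_congr rfl fun A _ => ?_
      ring
    rw [e]
    exact h
  -- the 2-chain `c → -t c → t² c`
  have h1 : ∀ E ∈ 𝒜 \\ 𝒜, ∑ A : 𝒜, c A * (if E ⊆ (A : Finset α) then (1 : K) else 0) =
      ∑ A : 𝒜, (-t * c A) * (if Disjoint E (A : Finset α) then (1 : K) else 0) := by
    intro E hE
    have h := hdep E hE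
    have h2 : ∑ A : 𝒜, (-t * c A) * (if Disjoint E (A : Finset α) then (1 : K) else 0) =
        -t * ∑ A : 𝒜, c A * (if Disjoint E (A : Finset α) then (1 : K) else 0) := by
      rw [mul_sum]; refine sum_congr rfl fun A _ => ?_; ring
    rw [h2]; linear_combination h
  have h2 : ∀ E ∈ 𝒜 \\ 𝒜, ∑ A : 𝒜, (-t * c A) * (if E ⊆ (A : Finset α) then (1 : K) else 0) =
      ∑ A : 𝒜, (t * t * c A) * (if Disjoint E (A : Finset α) then (1 : K) else 0) := by
    intro E hE
    have h := h1 E hE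
    have e1 : ∑ A : 𝒜, (-t * c A) * (if E ⊆ (A : Finset α) then (1 : K) else 0) =
        -t * ∑ A : 𝒜, c A * (if E ⊆ (A : Finset α) then (1 : K) else 0) := by
      rw [mul_sum]; refine sum_congr rfl fun A _ => ?_; ring
    have e2 : ∑ A : 𝒜, (t * t * c A) * (if Disjoint E (A : Finset α) then (1 : K) else 0) =
        -t * ∑ A : 𝒜, (-t * c A) * (if Disjoint E (A : Finset α) then (1 : K) else 0) := by
      rw [mul_sum]; refine sum_congr rfl fun A _ => ?_; ring
    rw [e1, e2, h]
  have hcn := hP2 c (fun A => -t * c A) (fun A => t * t * c A) h1 h2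
  intro A
  have hA := congr_fun hcn A
  -- `c A = t² c A` with `t² ≠ 1`
  have h3 : (1 - t * t) * c A = 0 := by linear_combination hA
  rcases mul_eq_zero.mp h3 with h4 | h4
  · exact absurd (by linear_combination -h4) ht
  · exact h4

/-- The alternating-sum ("±1") trick, containment form: `∑_{F ⊆ E} (-1)^{#F} [F ⊆ A] = [E ∩ A = ∅]`. -/
theorem sum_powerset_neg_one_pow_mul_subset (E A : Finset α) :
    ∑ F ∈ E.powerset, (-1 : K) ^ #F * (if F ⊆ A then (1 : K) else 0) = if Disjoint E A then 1 else 0 := by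
  have hf : E.powerset.filter (· ⊆ A) = (E ∩ A).powerset := by
    ext F
    simp only [mem_filter, mem_powerset, subset_inter_iff]
  have hZ := Finset.sum_powerset_neg_one_pow_card (x := E ∩ A)
  have hK : ∑ F ∈ (E ∩ A).powerset, (-1 : K) ^ #F = if E ∩ A = ∅ then 1 else 0 := by
    have h := congrArg (Int.cast : ℤ → K) hZ
    push_cast at h
    rw [h]
  simp_rw [mul_ite, mul_one, mul_zero]
  rw [← sum_filter, hf, hK]
  simp only [disjoint_iff_inter_eq_empty]

/-- The alternating-sum trick, disjointness form: `∑_{F ⊆ E} (-1)^{#F} [F ∩ A = ∅] = [E ⊆ A]`. -/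
theorem sum_powerset_neg_one_pow_mul_disjoint (E A : Finset α) :
    ∑ F ∈ E.powerset, (-1 : K) ^ #F * (if Disjoint F A then (1 : K) else 0) = if E ⊆ A then 1 else 0 := by
  have hf : E.powerset.filter (fun F => Disjoint F A) = (E \ A).powerset := by
    ext F
    simp only [mem_filter, mem_powerset, subset_sdiff]
  have hZ := Finset.sum_powerset_neg_one_pow_card (x := E \ A)
  have hK : ∑ F ∈ (E \ A).powerset, (-1 : K) ^ #F = if E \ A = ∅ then 1 else 0 := by
    have h := congrArg (Int.cast : ℤ → K) hZ
    push_cast at h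
    rw [h]
  simp_rw [mul_ite, mul_one, mul_zero]
  rw [← sum_filter, hf, hK]
  simp only [sdiff_eq_empty_iff_subset]

/-- **2-chain periodicity for subset-closed difference families.**  If `𝒜 \\ 𝒜` is closed under taking subsets, then `𝒜` has the
2-chain periodicity property over any field `K`: `λ Z = μ Y` and `μ Z = ν Y` on `𝒜 \\ 𝒜` force `λ = ν`.  [`Y = Z Ψ` and `Z = Y Ψ` for the
involution `Ψ F E = (-1)^{#F} [F ⊆ E]` on `𝒜 \\ 𝒜`, so `μ Y = ν Z Ψ² = ν Z`... precisely `μ Y(E) = ∑_{F ⊆ E} (-1)^{#F} (μ Z)(F) =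
∑_{F ⊆ E} (-1)^{#F} (ν Y)(F) = (ν Z)(E)`, and then Marica–Schönheim.] -/
theorem twoChain_of_diffs_downClosed (𝒜 : Finset (Finset α))
    (hD : ∀ E ∈ 𝒜 \\ 𝒜, ∀ F, F ⊆ E → F ∈ 𝒜 \\ 𝒜) (l m n : ↥𝒜 → K)
    (h1 : ∀ E ∈ 𝒜 \\ 𝒜, ∑ A : 𝒜, l A * (if E ⊆ (A : Finset α) then (1 : K) else 0) =
        ∑ A : 𝒜, m A * (if Disjoint E (A : Finset α) then (1 : K) else 0))
    (h2 : ∀ E ∈ 𝒜 \\ 𝒜, ∑ A : 𝒜, m A * (if E ⊆ (A : Finset α) then (1 : K) else 0) =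
        ∑ A : 𝒜, n A * (if Disjoint E (A : Finset α) then (1 : K) else 0)) : l = n := by
  classical
  -- `μ Y = ν Z` on `𝒜 \\ 𝒜`
  have h3 : ∀ E ∈ 𝒜 \\ 𝒜, ∑ A : 𝒜, m A * (if Disjoint E (A : Finset α) then (1 : K) else 0) =
      ∑ A : 𝒜, n A * (if E ⊆ (A : Finset α) then (1 : K) else 0) := by
    intro E hE
    calc ∑ A : 𝒜, m A * (if Disjoint E (A : Finset α) then (1 : K) else 0)
        = ∑ A : 𝒜, m A * ∑ F ∈ E.powerset, (-1 : K) ^ #F * (if F ⊆ (A : Finset α) then (1 : K) else 0) := by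
          refine sum_congr rfl fun A _ => ?_
          rw [sum_powerset_neg_one_pow_mul_subset]
      _ = ∑ F ∈ E.powerset, (-1 : K) ^ #F * ∑ A : 𝒜, m A * (if F ⊆ (A : Finset α) then (1 : K) else 0) := by
          simp_rw [mul_sum]
          rw [sum_comm]
          refine sum_congr rfl fun F _ => sum_congr rfl fun A _ => ?_
          ring
      _ = ∑ F ∈ E.powerset, (-1 : K) ^ #F * ∑ A : 𝒜, n A * (if Disjoint F (A : Finset α) then (1 : K) else 0) := by
          refine sum_congr rfl fun F hF => ?_
          rw [h2 F (hD E hE F (mem_powerset.mp hF))]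
      _ = ∑ A : 𝒜, n A * ∑ F ∈ E.powerset, (-1 : K) ^ #F * (if Disjoint F (A : Finset α) then (1 : K) else 0) := by
          simp_rw [mul_sum]
          rw [sum_comm]
          refine sum_congr rfl fun A _ => sum_congr rfl fun F _ => ?_
          ring
      _ = ∑ A : 𝒜, n A * (if E ⊆ (A : Finset α) then (1 : K) else 0) := by
          refine sum_congr rfl fun A _ => ?_
          rw [sum_powerset_neg_one_pow_mul_disjoint]
  -- hence `(λ - ν) Z = 0` on `𝒜 \\ 𝒜`, and Marica–Schönheim over `K` gives `λ = ν`
  have h4 := eq_zero_of_sum_incidence_diffs_eq_zero (K := K) 𝒜 (fun A => l A - n A) (by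
    intro E hE
    have e : ∑ A : 𝒜, (l A - n A) * (if E ⊆ (A : Finset α) then (1 : K) else 0) =
        ∑ A : 𝒜, l A * (if E ⊆ (A : Finset α) then (1 : K) else 0) -
          ∑ A : 𝒜, n A * (if E ⊆ (A : Finset α) then (1 : K) else 0) := by
      rw [← sum_sub_distrib]; refine sum_congr rfl fun A _ => ?_; ring
    rw [e, h1 E hE, h3 E hE, sub_self])
  funext A
  have := congr_fun h4 A
  simp only [Pi.zero_apply] at this
  linear_combination this

/-- **MS-PENCIL over every field for subset-closed difference families.**  If `𝒜 \\ 𝒜` is closed under taking subsets (for instance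
`𝒜` is a down-set containing `∅`), then for every field `K` and every `t ∈ K` with `t * t ≠ 1` the pencil rows
`A ↦ (E ↦ [E ⊆ A] + t [E ∩ A = ∅])` over `𝒜 \\ 𝒜` are linearly independent over `K`. -/
theorem linearIndependent_pencil_of_diffs_downClosed (𝒜 : Finset (Finset α))
    (hD : ∀ E ∈ 𝒜 \\ 𝒜, ∀ F, F ⊆ E → F ∈ 𝒜 \\ 𝒜) {t : K} (ht : t * t ≠ 1) :
    LinearIndependent K (fun A : 𝒜 => fun E : (𝒜 \\ 𝒜 : Finset (Finset α)) =>
      (if (E : Finset α) ⊆ (A : Finset α) then (1 : K) else 0) +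
        t * (if Disjoint (E : Finset α) (A : Finset α) then (1 : K) else 0)) :=
  linearIndependent_pencil_of_twoChain 𝒜 (fun l m n h1 h2 => twoChain_of_diffs_downClosed 𝒜 hD l m n h1 h2) ht

/-- **2-chain periodicity for complement-closed families.**  If every member of `𝒜` lies in `S` and `𝒜` is closed under
`A ↦ S \ A`, then `𝒜` has the 2-chain periodicity property over any field: on `𝒜 \\ 𝒜` the disjointness row of `A` is the
containment row of `S \ A`, so `λ Z = μ Y` means `λ = μ ∘ c` (Marica–Schönheim), and two steps of `c` are the identity. -/
theorem twoChain_of_complClosed (𝒜 : Finset (Finset α)) (S : Finset α) (hS : ∀ A ∈ 𝒜, A ⊆ S)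
    (hc : ∀ A ∈ 𝒜, S \ A ∈ 𝒜) (l m n : ↥𝒜 → K)
    (h1 : ∀ E ∈ 𝒜 \\ 𝒜, ∑ A : 𝒜, l A * (if E ⊆ (A : Finset α) then (1 : K) else 0) =
        ∑ A : 𝒜, m A * (if Disjoint E (A : Finset α) then (1 : K) else 0))
    (h2 : ∀ E ∈ 𝒜 \\ 𝒜, ∑ A : 𝒜, m A * (if E ⊆ (A : Finset α) then (1 : K) else 0) =
        ∑ A : 𝒜, n A * (if Disjoint E (A : Finset α) then (1 : K) else 0)) : l = n := by
  classical
  -- the complementation involution on `𝒜`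
  let κ : ↥𝒜 → ↥𝒜 := fun A => ⟨S \ (A : Finset α), hc A A.2⟩
  have hκ : Function.Involutive κ := by
    intro A
    apply Subtype.ext
    show S \ (S \ (A : Finset α)) = A
    rw [sdiff_sdiff_right_self, inf_eq_inter, inter_eq_right.mpr (hS A A.2)]
  let e : ↥𝒜 ≃ ↥𝒜 := hκ.toPerm κ
  -- every word lies in `S`, so `[E ∩ A = ∅] = [E ⊆ S \ A]`
  have hE : ∀ E ∈ 𝒜 \\ 𝒜, ∀ A : 𝒜,
      (if Disjoint E (A : Finset α) then (1 : K) else 0) = if E ⊆ ((κ A : ↥𝒜) : Finset α) then 1 else 0 := by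
    intro E hE A
    obtain ⟨B, hB, C, -, rfl⟩ := mem_diffs.mp hE
    have hsub : B \ C ⊆ S := (sdiff_subset).trans (hS B hB)
    have : Disjoint (B \ C) (A : Finset α) ↔ B \ C ⊆ S \ (A : Finset α) := by
      rw [subset_sdiff]; exact ⟨fun h => ⟨hsub, h⟩, fun h => h.2⟩
    simp only [this]
    rfl
  -- the disjointness sums are containment sums of the complemented measure
  have hY : ∀ (m : ↥𝒜 → K), ∀ E ∈ 𝒜 \\ 𝒜,
      ∑ A : 𝒜, m A * (if Disjoint E (A : Finset α) then (1 : K) else 0) =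
        ∑ A : 𝒜, m (κ A) * (if E ⊆ (A : Finset α) then (1 : K) else 0) := by
    intro m E hEm
    have step : ∑ A : 𝒜, m A * (if Disjoint E (A : Finset α) then (1 : K) else 0) =
        ∑ A : 𝒜, m A * (if E ⊆ ((κ A : ↥𝒜) : Finset α) then (1 : K) else 0) :=
      sum_congr rfl fun A _ => by rw [hE E hEm A]
    rw [step]
    rw [← Equiv.sum_comp e (fun A : ↥𝒜 => m A * (if E ⊆ ((κ A : ↥𝒜) : Finset α) then (1 : K) else 0))]
    refine sum_congr rfl fun A _ => ?_
    have h3 : (e A) = κ A := rfl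
    rw [h3]
    have h4 : κ (κ A) = A := hκ A
    rw [h4]
  -- `λ = μ ∘ κ` and `μ = ν ∘ κ`
  have hlm : l = m ∘ κ := by
    have h := eq_zero_of_sum_incidence_diffs_eq_zero (K := K) 𝒜 (fun A => l A - m (κ A)) (by
      intro E hEm
      have e1 : ∑ A : 𝒜, (l A - m (κ A)) * (if E ⊆ (A : Finset α) then (1 : K) else 0) =
          ∑ A : 𝒜, l A * (if E ⊆ (A : Finset α) then (1 : K) else 0) -
            ∑ A : 𝒜, m (κ A) * (if E ⊆ (A : Finset α) then (1 : K) else 0) := by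
        rw [← sum_sub_distrib]; refine sum_congr rfl fun A _ => ?_; ring
      rw [e1, h1 E hEm, hY m E hEm, sub_self])
    funext A
    have := congr_fun h A
    exact sub_eq_zero.mp this
  have hmn : m = n ∘ κ := by
    have h := eq_zero_of_sum_incidence_diffs_eq_zero (K := K) 𝒜 (fun A => m A - n (κ A)) (by
      intro E hEm
      have e1 : ∑ A : 𝒜, (m A - n (κ A)) * (if E ⊆ (A : Finset α) then (1 : K) else 0) =
          ∑ A : 𝒜, m A * (if E ⊆ (A : Finset α) then (1 : K) else 0) -
            ∑ A : 𝒜, n (κ A) * (if E ⊆ (A : Finset α) then (1 : K) else 0) := by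
        rw [← sum_sub_distrib]; refine sum_congr rfl fun A _ => ?_; ring
      rw [e1, h2 E hEm, hY n E hEm, sub_self])
    funext A
    have := congr_fun h A
    exact sub_eq_zero.mp this
  funext A
  rw [hlm, Function.comp_apply, hmn, Function.comp_apply, hκ A]

/-- **MS-PENCIL over every field for complement-closed families.** -/
theorem linearIndependent_pencil_of_complClosed (𝒜 : Finset (Finset α)) (S : Finset α)
    (hS : ∀ A ∈ 𝒜, A ⊆ S) (hc : ∀ A ∈ 𝒜, S \ A ∈ 𝒜) {t : K} (ht : t * t ≠ 1) :
    LinearIndependent K (fun A : 𝒜 => fun E : (𝒜 \\ 𝒜 : Finset (Finset α)) =>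
      (if (E : Finset α) ⊆ (A : Finset α) then (1 : K) else 0) +
        t * (if Disjoint (E : Finset α) (A : Finset α) then (1 : K) else 0)) :=
  linearIndependent_pencil_of_twoChain 𝒜 (fun l m n h1 h2 => twoChain_of_complClosed 𝒜 S hS hc l m n h1 h2) ht

end OrderedDifferences

end Summit.CriticalPhenomena.PercolationContinuityZ3.Theorems
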